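import Mathlib
import Summits.Ventures.PercRepro2.Graph
import Summits.Ventures.PercRepro2.Exploration
import Summits.Ventures.PercRepro2.Harris
import Summits.Ventures.PercRepro2.GibbsPAJoint
import Summits.Ventures.PercRepro2.SepClusterJoint
import Summits.Ventures.PercRepro2.SepClusterSupport
import Summits.Ventures.PercRepro2.SepClusterHarris

/-!
# The separated cluster is positively associated — single-root form (blind cell PercRepro2,
p3 g12, 2026-08-27; `proofs/P3-G2.md` Theorem A with `X = {x}`, `Y = {y}`)

Part 4 (the theorem).  Conditioned on `{x ↮ y}`, the random set `C(y)` is positively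
associated: for `g₁, g₂ : Set V → ℝ` monotone,
  `E[1_S · g₁(C(y))] · E[1_S · g₂(C(y))] ≤ P(S) · E[1_S · g₁(C(y)) g₂(C(y))]`
(`sep_cluster_pa`), edge weights strictly inside `(0, 1)`, `x ≠ y`.  The proof is the monotone
two-cluster Gibbs sampler of `P3-G2.md` §3 through `GibbsPAJoint.cov_nonneg_of_joint`: the
conditional Harris inequalities and the monotone conditional expectations of
`SepClusterHarris`, and the MINORISATION by the minimal `x`-cluster `{x}` proved here
(`minorisation`: `∏_{e at x} (1 − p e) · P(S) · q D' ≤ gibbsKernel J D D'` on the support rows —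
`P(C_{G − D}(x) = {x}) ≥ ∏_{e at x}(1 − p e)` and `P(C_{G − {x}}(y) = D') ≥ P(C(y) = D', S)`).
The boundary cases `p e ∈ {0, 1}` follow by continuity and are left to the paper.  Own work;
standard axioms.
-/

namespace Summit.Ventures.PercRepro2

namespace SepPA

open Finset Classical

section Separated

variable {V : Type*} {E : Type*} [Fintype V] [Fintype E] [DecidableEq E]
variable (ends : E → Sym2 V) (p : E → ℝ) (x y : V)

variable {x y}

/-- The edges at `x`, as a `Finset`. -/
noncomputable def star (x : V) : Finset E := Finset.univ.filter (fun e => e ∈ touches ends {x})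

omit [Fintype V] [DecidableEq E] in
/-- If every edge at `x` is closed, the cluster of `x` explored away from anything is `{x}`. -/
lemma clAway_eq_singleton_of_allClosed (D : Set V) {ω : Config E}
    (h : ω ∈ allClosed (star ends x)) : clAway ends D x ω = {x} := by
  unfold clAway
  apply cluster_eq_singleton_of_closed
  intro e he
  have hωe : ω e = false := h e (by simp [star, he])
  cases hr : restrict (touches ends D)ᶜ ω e
  · rfl
  · exfalso
    have := (restrict_eq_true_iff.mp hr).1
    rw [hωe] at this
    exact Bool.false_ne_true this

omit [Fintype V] in
/-- `P(C_{G − D}(x) = {x}) ≥ ∏_{e at x} (1 − p e)`. -/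
lemma prod_le_prob_clAway_singleton (hp01 : ∀ e, 0 < p e ∧ p e < 1) (D : Set V) :
    ∏ e ∈ star ends x, (1 - p e) ≤ prob p {ω | clAway ends D x ω = {x}} := by
  rw [← prob_allClosed]
  apply prob_mono (isProbVec_of_interior p hp01)
  intro ω hω
  exact clAway_eq_singleton_of_allClosed ends D hω

omit [Fintype V] [Fintype E] [DecidableEq E] in
/-- On `{C(y) = D'} ∩ {x ↮ y}`, removing the edges at `x` does not change the cluster of `y`. -/
lemma clAway_singleton_eq_of_mem {D' : Set V} {ω : Config E}
    (hω : ω ∈ clusterEvent ends y D' ∩ sepEvent ends x y) : clAway ends {x} y ω = D' := by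
  have hx : x ∉ D' := not_mem_of_mem_sepEvent hω.1 hω.2
  unfold clAway
  apply cluster_eq_of_eqOn_touches _ hω.1
  intro e he
  by_cases hex : e ∈ touches ends {x}
  · have hnot : e ∉ (touches ends {x})ᶜ := by simpa using hex
    rw [restrict_apply_of_notMem hnot]
    obtain ⟨a, ha, b, hab⟩ := hex
    rw [Set.mem_singleton_iff] at ha
    obtain ⟨a', ha', b', hab'⟩ := he
    cases h : ω e
    · rfl
    · exfalso
      -- an open edge with one end in `D' = C(y)` has its other end in `D'`
      have hadj : ∀ u v : V, ends e = s(u, v) → u ∈ D' → v ∈ D' := by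
        intro u v huv hu
        have hmem : u ∈ cluster ends ω y := by rw [hω.1]; exact hu
        have hv : v ∈ cluster ends ω y := by
          by_cases huv' : u = v
          · rw [← huv']; exact hmem
          · exact mem_cluster_of_adj hmem (openGraph_adj.2 ⟨huv', e, h, huv⟩)
        rw [hω.1] at hv
        exact hv
      rw [ha] at hab
      rw [hab, Sym2.eq_iff] at hab'
      rcases hab' with ⟨h1, _⟩ | ⟨h1, h2⟩
      · exact hx (by rw [h1]; exact ha')
      · have hb : b ∈ D' := by rw [h2]; exact ha'
        exact hx (hadj b x (by rw [hab, Sym2.eq_swap]) hb)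
  · have hmem : e ∈ (touches ends {x})ᶜ := hex
    rw [restrict_apply_of_mem hmem]

omit [Fintype V] in
/-- `P(C(y) = D', x ↮ y) ≤ P(C_{G − {x}}(y) = D')`. -/
lemma prob_le_prob_clAway_singleton (hp01 : ∀ e, 0 < p e ∧ p e < 1) (D' : Set V) :
    prob p (clusterEvent ends y D' ∩ sepEvent ends x y) ≤
      prob p {ω | clAway ends {x} y ω = D'} := by
  apply prob_mono (isProbVec_of_interior p hp01)
  intro ω hω
  exact clAway_singleton_eq_of_mem ends hω

omit [Fintype V] [Fintype E] [DecidableEq E] in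
/-- The all-closed configuration has `C(x) = {x}`. -/
lemma allFalse_mem_clusterEvent_singleton :
    (fun _ => false : Config E) ∈ clusterEvent ends x {x} :=
  cluster_eq_singleton_of_closed (fun _ _ => rfl)

/-- **Minorisation**: the Gibbs kernel dominates `δ · q` on the support rows, with
`δ = ∏_{e at x} (1 − p e) · P(x ↮ y)`. -/
theorem minorisation (hp01 : ∀ e, 0 < p e ∧ p e < 1) (hxy : x ≠ y) (D D' : Set V)
    (hD : (∑ K, J ends p x y D K) ≠ 0) :
    (∏ e ∈ star ends x, (1 - p e)) * prob p (sepEvent ends x y) * (∑ K, J ends p x y D' K) ≤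
      GibbsPAJoint.gibbsKernel (J ends p x y) D D' := by
  have hJ0 : ∀ D K, 0 ≤ J ends p x y D K := J_nonneg ends p hp01
  have hS : prob p (sepEvent ends x y) ≠ 0 := ne_of_gt (prob_sepEvent_pos ends p hp01 hxy)
  have hS0 : 0 ≤ prob p (sepEvent ends x y) := le_of_lt (prob_sepEvent_pos ends p hp01 hxy)
  -- the term `K = {x}`
  have hterm : (J ends p x y D {x} / ∑ K, J ends p x y D K) *
      (J ends p x y D' {x} / ∑ D'', J ends p x y D'' {x}) ≤
      GibbsPAJoint.gibbsKernel (J ends p x y) D D' := by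
    unfold GibbsPAJoint.gibbsKernel
    apply Finset.single_le_sum (f := fun K => (J ends p x y D K / ∑ K', J ends p x y D K') *
      (J ends p x y D' K / ∑ s'', J ends p x y s'' K)) _ (Finset.mem_univ ({x} : Set V))
    intro K _
    apply mul_nonneg
    · exact div_nonneg (hJ0 D K) (Finset.sum_nonneg (fun K' _ => hJ0 D K'))
    · exact div_nonneg (hJ0 D' K) (Finset.sum_nonneg (fun D'' _ => hJ0 D'' K))
  -- (i) the first factor is `P(C_{G − D}(x) = {x})`
  obtain ⟨ω₀, hω₀⟩ := exists_mem_of_sum_J_right_ne_zero ends p hD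
  have hx : x ∉ D := not_mem_of_mem_sepEvent hω₀.1 hω₀.2
  have hsub : clusterEvent ends y D ∩ sepEvent ends x y = clusterEvent ends y D :=
    Set.inter_eq_left.mpr (fun ω hω => mem_sepEvent_of_cluster_eq hω hx)
  have hpos : prob p (clusterEvent ends y D) ≠ 0 := by
    rw [← hsub]; exact ne_of_gt (prob_pos_of_mem p hp01 hω₀)
  have e1 : J ends p x y D {x} / ∑ K, J ends p x y D K =
      prob p {ω | clAway ends D x ω = {x}} := by
    rw [sum_J_right, hsub]
    unfold J
    rw [prob_joint_eq ends p x y hx {x}]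
    field_simp
  -- (ii) the second factor is `P(C_{G − {x}}(y) = D')`
  have hy : y ∉ ({x} : Set V) := by
    rw [Set.mem_singleton_iff]; exact fun h => hxy h.symm
  have hsub' : clusterEvent ends x {x} ∩ sepEvent ends x y = clusterEvent ends x {x} :=
    Set.inter_eq_left.mpr (fun ω hω => mem_sepEvent_of_cluster_eq' hω hy)
  have hpos' : prob p (clusterEvent ends x {x}) ≠ 0 :=
    ne_of_gt (prob_pos_of_mem p hp01 (allFalse_mem_clusterEvent_singleton ends (x := x)))
  have e2 : J ends p x y D' {x} / ∑ D'', J ends p x y D'' {x} =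
      prob p {ω | clAway ends {x} y ω = D'} := by
    rw [sum_J_left, hsub']
    unfold J
    rw [prob_joint_eq' ends p x y hy D']
    field_simp
  rw [e1, e2] at hterm
  -- (iii) the bounds
  have b1 := prod_le_prob_clAway_singleton ends p (x := x) hp01 D
  have b2 := prob_le_prob_clAway_singleton ends p (x := x) (y := y) hp01 D'
  have hq' : prob p (clusterEvent ends y D' ∩ sepEvent ends x y) =
      (∑ K, J ends p x y D' K) * prob p (sepEvent ends x y) := by
    rw [sum_J_right]
    field_simp
  rw [hq'] at b2
  have hc0 : 0 ≤ ∏ e ∈ star ends x, (1 - p e) :=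
    Finset.prod_nonneg (fun e _ => by linarith [(hp01 e).2])
  have hq0 : 0 ≤ ∑ K, J ends p x y D' K := Finset.sum_nonneg (fun K _ => hJ0 D' K)
  calc (∏ e ∈ star ends x, (1 - p e)) * prob p (sepEvent ends x y) * (∑ K, J ends p x y D' K)
      = (∏ e ∈ star ends x, (1 - p e)) *
          ((∑ K, J ends p x y D' K) * prob p (sepEvent ends x y)) := by ring
    _ ≤ prob p {ω | clAway ends D x ω = {x}} * prob p {ω | clAway ends {x} y ω = D'} :=
        mul_le_mul b1 b2 (mul_nonneg hq0 hS0)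
          (prob_nonneg (isProbVec_of_interior p hp01) _)
    _ ≤ _ := hterm

/-! ### Assembly -/

/-- Monotone functions of sets are monotone on the support. -/
lemma incY_of_monotone {g : Set V → ℝ} (hg : Monotone g) : IncY ends p x y g :=
  fun _ _ _ _ h => hg h

/-- The joint law sums to `1`. -/
lemma sum_sum_J (hp01 : ∀ e, 0 < p e ∧ p e < 1) (hxy : x ≠ y) :
    ∑ D, ∑ K, J ends p x y D K = 1 := by
  have hS : prob p (sepEvent ends x y) ≠ 0 := ne_of_gt (prob_sepEvent_pos ends p hp01 hxy)
  simp_rw [sum_J_right]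
  rw [← Finset.sum_div]
  have : ∑ D : Set V, prob p (clusterEvent ends y D ∩ sepEvent ends x y) =
      prob p (sepEvent ends x y) := by
    rw [prob_eq_sum_prob_inter p (sepEvent ends x y) (fun ω => cluster ends ω y)]
    apply Finset.sum_congr rfl
    intro D _
    rw [Set.inter_comm]
    rfl
  rw [this, div_self hS]

/-- The expectation of `1_S · g(C(y))` through the `y`-marginal. -/
lemma expect_indicator_cluster (hp01 : ∀ e, 0 < p e ∧ p e < 1) (hxy : x ≠ y)
    (g : Set V → ℝ) :
    expect p (fun ω => (sepEvent ends x y).indicator (fun _ => (1 : ℝ)) ω * g (cluster ends ω y))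
      = prob p (sepEvent ends x y) * ∑ D, (∑ K, J ends p x y D K) * g D := by
  have hS : prob p (sepEvent ends x y) ≠ 0 := ne_of_gt (prob_sepEvent_pos ends p hp01 hxy)
  rw [expect_indicator_comp_eq_sum p (sepEvent ends x y) (fun ω => cluster ends ω y) g,
    Finset.mul_sum]
  apply Finset.sum_congr rfl
  intro D _
  rw [sum_J_right]
  have : sepEvent ends x y ∩ {ω | cluster ends ω y = D} =
      clusterEvent ends y D ∩ sepEvent ends x y := by
    rw [Set.inter_comm]; rfl
  rw [this]
  field_simp

/-- **The core of Theorem A**: under `P(· | x ↮ y)`, two functions of the `y`-cluster that are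
monotone on the support have non-negative covariance (the Gibbs sampler
`GibbsPAJoint.cov_nonneg_of_joint` on the joint law `J`). -/
theorem cov_nonneg_incY (hp01 : ∀ e, 0 < p e ∧ p e < 1) (hxy : x ≠ y) (g₁ g₂ : Set V → ℝ)
    (h₁ : IncY ends p x y g₁) (h₂ : IncY ends p x y g₂) :
    0 ≤ GibbsPAq.cov (fun D => ∑ K, J ends p x y D K) g₁ g₂ := by
  have hδ : 0 < (∏ e ∈ star ends x, (1 - p e)) * prob p (sepEvent ends x y) :=
    mul_pos (Finset.prod_pos (fun e _ => by linarith [(hp01 e).2]))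
      (prob_sepEvent_pos ends p hp01 hxy)
  exact GibbsPAJoint.cov_nonneg_of_joint (J ends p x y) (J_nonneg ends p hp01)
    (sum_sum_J ends p hp01 hxy) (IncY ends p x y) (AntiX ends p x y)
    (fun g hg => antiX_condS ends p hp01 hxy hg)
    (fun F hF => incY_condS_transpose ends p hp01 hxy hF)
    (fun g₁ g₂ hg₁ hg₂ K => harris_right ends p hp01 hxy g₁ g₂ hg₁ hg₂ K)
    (fun F₁ F₂ hF₁ hF₂ D => harris_left ends p hp01 hxy F₁ F₂ hF₁ hF₂ D)
    _ hδ (fun D D' hD => minorisation ends p hp01 hxy D D' hD) g₁ g₂ h₁ h₂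

/-- **The separated cluster is positively associated (single-root form, Theorem A of
`P3-G2.md`).**  For edge weights in `(0,1)`, `x ≠ y`, and monotone `g₁, g₂ : Set V → ℝ`:
`E[1_S g₁(C(y))] · E[1_S g₂(C(y))] ≤ P(S) · E[1_S g₁(C(y)) g₂(C(y))]`, `S = {x ↮ y}`. -/
theorem sep_cluster_pa (hp01 : ∀ e, 0 < p e ∧ p e < 1) (hxy : x ≠ y) (g₁ g₂ : Set V → ℝ)
    (h₁ : Monotone g₁) (h₂ : Monotone g₂) :
    expect p (fun ω => (sepEvent ends x y).indicator (fun _ => (1 : ℝ)) ω *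
        g₁ (cluster ends ω y)) *
      expect p (fun ω => (sepEvent ends x y).indicator (fun _ => (1 : ℝ)) ω *
        g₂ (cluster ends ω y)) ≤
    prob p (sepEvent ends x y) *
      expect p (fun ω => (sepEvent ends x y).indicator (fun _ => (1 : ℝ)) ω *
        (g₁ (cluster ends ω y) * g₂ (cluster ends ω y))) := by
  have hcov := cov_nonneg_incY ends p hp01 hxy g₁ g₂ (incY_of_monotone ends p h₁)
    (incY_of_monotone ends p h₂)
  unfold GibbsPAq.cov at hcov
  rw [expect_indicator_cluster ends p hp01 hxy g₁, expect_indicator_cluster ends p hp01 hxy g₂,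
    expect_indicator_cluster ends p hp01 hxy (fun D => g₁ D * g₂ D)]
  have hS0 : 0 ≤ prob p (sepEvent ends x y) := le_of_lt (prob_sepEvent_pos ends p hp01 hxy)
  have := mul_le_mul_of_nonneg_left hcov (mul_nonneg hS0 hS0)
  nlinarith [this]

end Separated

end SepPA

end Summit.Ventures.PercRepro2
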